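import Summits.BirchSwinnertonDyer.BirchSwinnertonDyer.Theorems.SignedLowerHalvesKobayashiLowerHalfLargeImageMuPart
import Summits.BirchSwinnertonDyer.Rank1Residual.X2.LambdaMinimal
import Literature.NumberTheory.EllipticCurves.Kobayashi2003.SignedSelmerRankBoundProofs
import Literature.NumberTheory.EllipticCurves.Rank1Residual.PeriodUnitProofs
import Literature.NumberTheory.EllipticCurves.SupersingularIrreducibleProofs
import HarnessLib

/-!
# Route `SignedLowerHalves`, crux 3 `KobayashiLowerHalfLargeImage` (item stmt-BirchSwinnertonDyer-19001):
# the SIGN-BLIND RANK SQUEEZE — ONE inequality `λ(L_p^{ε₁}(E)) ≤ rank E(ℚ)` for ONE sign (no μ-certificate) gives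
# Kobayashi's main conjecture for BOTH signs at a large-image pair (`p = 3` mod published facts; `p ≥ 5` mod B⁰)
# (cell `bsd-ssimc`, width seat `bsd-line-slh-p1-w6` gen 0; helper file `--supports 19001`; THEOREMS ONLY)

HONEST FRAMING.  The crux is OPEN and nothing here proves it class-wide; BSD is not proved by any of this.  PER PAIR in its
certificate (`λ(L_p^{ε₁}) ≤ rank E(ℚ)` for the newform's Pollack pair); CLASS-WIDE in every other binder.  CONDITIONAL on the
PUBLISHED named facts `h12`, `h41`, `h5`, `h3`, `hJ` and — ONLY at `p ≥ 5` — Conjecture B⁰ `TeichSpanGenAll`.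

## The squeeze (compare k3-c3 gen 8, `CongruenceRoad.kobayashiMainConjecture_of_cert_of_le_mordellWeilRank_at_conductor`)

The tree's higher-rank squeeze needs, for the sign `ε` in question, the TWO-engine certificate `(μ, λ)(L_p^ε) = (0, l)` with
`l ≤ rank E(ℚ)` and concludes the main conjecture for THAT sign.  With the sign-blind defect `δ` of unit content
(`LargeImageMuPart.exists_signBlindDefect_hasUnitContent`: `(ξ^ε·δ) = (L_p^ε)` for both signs, `μ(δ) = 0`):
`λ(ξ^{ε₁}) + λ(δ) = λ(L_p^{ε₁}) ≤ rank E(ℚ) ≤ λ(ξ^{ε₁})` (control theorem `T^{rank E(ℚ)} ∣ ξ^{ε₁}`,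
`X_pow_mordellWeilRank_dvd_of_charIdeal_eq_span`) forces `λ(δ) = 0`, so `δ ∈ Λˣ` and `char X^ε = (L_p^ε)` for BOTH signs:
* NO `μ`-certificate (the μ-inequality is an EQUALITY for both signs);
* ONE sign's λ-inequality gives BOTH signs' main conjecture;
* only `λ(L_p^{ε₁}) ≤ rank E(ℚ)` (not `=`, not `T^λ ∣ L_p^{ε₁}`).

Contents: `kobayashiMainConjecture_forall_of_lam_le_mordellWeilRank_of_muFloor` (core, μ-floor as hypothesis),
`…_three` (PUB facts only), `…_of_teichSpanGenAll` (odd `p`, B⁰ only at `p ≥ 5`), the `IsSignedPAdicLFunction`-currency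
certificate form `…_of_cert_at_conductor`, and the X7 reading `X7.exists_kobayashiLowerDivisibility_of_lam_le_mordellWeilRank`
(the crux's conclusion shape at the pair).  CALIBRATION / SUPPORT ONLY (pen rule D34-4 (3)).

References: [Kobayashi2003] Conjecture (p. 2), Thm. 1.2, Thm. 4.1, proof of Thm. 7.4 (p. 13); [GreenbergLNM1716] §3 Lemma 3.1;
[GreenbergVatsal2000] p. 4, §3 Rem. 3.4; [PollackWeston2011] Rem. 4.2; [Vaserstein1972SL2] Theorem; [Pollack2003] Prop. 6.18.
-/

-- D-0017: single-problem summit, the namespace repeats the problem name by design.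
set_option linter.dupNamespace false
set_option autoImplicit false

noncomputable section

open scoped Classical MatrixGroups ModularForm

open CongruenceSubgroup WeierstrassCurve Literature.NumberTheory.EllipticCurves
  Literature.NumberTheory.EllipticCurves.ModularForms
  Literature.NumberTheory.EllipticCurves.Kobayashi2003 Literature.NumberTheory.EllipticCurves.GreenbergVatsal2000
  Literature.NumberTheory.EllipticCurves.Rank1Residual ZpExtension
  Summit.BirchSwinnertonDyer.Rank1Residual.Supersingular

namespace Summit.BirchSwinnertonDyer.BirchSwinnertonDyer.Theorems.LargeImageMuPartSqueeze

open Summit.BirchSwinnertonDyer.Rank1Residual.X1.MuLambda (mu lam isUnit_iff_mu_eq_zero_and_lam_eq_zero)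
open Summit.BirchSwinnertonDyer.Rank1Residual.X11a (ne_zero_of_hasUnitContent mu_eq_zero_of_hasUnitContent)
open Summit.BirchSwinnertonDyer.BirchSwinnertonDyer.Cruxes.AnalyticMuZeroX9.TeichSpan (TeichSpanGenAll)
open Summit.BirchSwinnertonDyer.BirchSwinnertonDyer.Theorems.LargeImageMuPart
  (exists_signBlindDefect_hasUnitContent_of_muFloor mu_eq_and_lam_add_eq_of_span_mul_eq_span)

section Squeeze

variable {p : ℕ} [Fact p.Prime] {W : WeierstrassCurve ℚ} [W.IsElliptic] [W.IsGloballyMinimal]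

/-- **THE SIGN-BLIND RANK SQUEEZE, μ-floor as a hypothesis.**  GRANTED `h12`, `h41`, `h5`, `h3`, `hJ` (PUBLISHED) and the
μ-floor `hfloor` at `(W, p)`: for `p` odd good, `a_p = 0`, `ρ̄_{E,p}` onto, if for ONE sign `ε₁` the newform's signed
`p`-adic `L`-function has `λ(L_p^{ε₁}) ≤ rank E(ℚ)` (for every Pollack pair — they all give the same `kobayashiL ε₁`), then
`KobayashiMainConjecture W p ε` for EVERY sign `ε`.  No `μ`-certificate; `λ ≤ rank`, not `=`.
[cite: Kobayashi2003, Conjecture (p. 2), Thm. 1.2, Thm. 4.1, proof of Thm. 7.4 (p. 13)] [cite: GreenbergLNM1716, §3 Lemma 3.1]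
[cite: GreenbergVatsal2000, p. 4 and §3 Remark 3.4] -/
theorem kobayashiMainConjecture_forall_of_lam_le_mordellWeilRank_of_muFloor
    (h12 : Kobayashi2003.thm12_signedSelmerDual_finite_torsion)
    (h41 : Kobayashi2003.thm41_signedCharIdeal_divisibility)
    (h5 : realPeriodRat_eq_unit_mul_plusPeriod) (h3 : realPeriodRat_eq_unit_mul_plusPeriod_three)
    (hJ : Kobayashi2003.thm62_63_73_signedColemanKato_zetaJoint)
    (hfloor : ∃ ε₀ : ℤˣ, ∀ [NeZero (W.conductorNorm ℤ)] (f : CuspForm (Gamma0 (W.conductorNorm ℤ)) 2),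
      IsNewformOf W f → ∀ Lplus Lminus : IwasawaAlgebra p, IsPollackPair f p Lplus Lminus →
        HasUnitContent (kobayashiL ε₀ Lplus Lminus))
    (hp2 : p ≠ 2) (hgood : W.HasGoodReductionAtPrime p) (hap : W.frobeniusTrace p = 0) (hs : Surj W p)
    (ε₁ : ℤˣ)
    (hcert : ∀ [NeZero (W.conductorNorm ℤ)] (f : CuspForm (Gamma0 (W.conductorNorm ℤ)) 2),
      IsNewformOf W f → ∀ Lplus Lminus : IwasawaAlgebra p, IsPollackPair f p Lplus Lminus →
        lam (kobayashiL ε₁ Lplus Lminus) ≤ W.mordellWeilRank) :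
    ∀ ε : ℤˣ, KobayashiMainConjecture W p ε := by
  intro ε κ γ hκ hγ hγc _ f hf ϖ hϖ Lplus Lminus hPP D
  haveI : Module.Finite (IwasawaAlgebra p) D.X := h12.moduleFinite hp2 hgood hap hκ hγ D
  have hX : Module.IsTorsion (IwasawaAlgebra p) D.X := h12.isTorsion hp2 hgood hap hκ hγ D
  refine ⟨hX, ?_⟩
  -- the sign-blind defect of unit content
  obtain ⟨δ, hδu, hδ⟩ :=
    exists_signBlindDefect_hasUnitContent_of_muFloor h12 h41 h5 h3 hJ hfloor hp2 hgood hap hs hκ hγ hγc hf hPP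
  have hL0 : ∀ s : ℤˣ, kobayashiL s Lplus Lminus ≠ 0 := by
    intro s
    rcases Int.units_eq_one_or s with rfl | rfl
    · simpa [kobayashiL] using hPP.2.1
    · have hne : (-1 : ℤˣ) ≠ 1 := by decide
      simpa [kobayashiL, hne] using hPP.1
  -- read `λ(δ) = 0` on the certificate sign `ε₁`
  obtain ⟨D₁⟩ := nonempty_signedSelmerDualData W κ ε₁ hγ
  obtain ⟨ξ₁, hξ₁, hspan₁⟩ := hδ ε₁ D₁
  haveI : Module.Finite (IwasawaAlgebra p) D₁.X := h12.moduleFinite hp2 hgood hap hκ hγ D₁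
  have hX₁ : Module.IsTorsion (IwasawaAlgebra p) D₁.X := h12.isTorsion hp2 hgood hap hκ hγ D₁
  have hξ₁0 : ξ₁ ≠ 0 := by
    intro h0
    rw [h0, zero_mul, Ideal.span_singleton_eq_span_singleton] at hspan₁
    exact hL0 ε₁ (zero_dvd_iff.mp hspan₁.dvd)
  have hC : (PowerSeries.X : IwasawaAlgebra p) ^ W.mordellWeilRank ∣ ξ₁ :=
    D₁.X_pow_mordellWeilRank_dvd_of_charIdeal_eq_span hγ hX₁ hξ₁
  have hrank : W.mordellWeilRank ≤ lam ξ₁ :=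
    Summit.BirchSwinnertonDyer.Rank1Residual.X2.le_lam_of_X_pow_dvd hξ₁0 hC
  obtain ⟨-, hlam₁⟩ := mu_eq_and_lam_add_eq_of_span_mul_eq_span (hL0 ε₁) hδu hspan₁
  have hcert₁ := hcert f hf Lplus Lminus hPP
  have hlamδ : lam δ = 0 := by omega
  have hδunit : IsUnit δ :=
    (isUnit_iff_mu_eq_zero_and_lam_eq_zero δ).mpr
      ⟨ne_zero_of_hasUnitContent hδu, mu_eq_zero_of_hasUnitContent hδu, hlamδ⟩
  -- the requested sign `ε`: `(ξ) = (ξ δ) = (L^ε)`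
  obtain ⟨ξ, hξ, hspan⟩ := hδ ε D
  have hchar : D.charIdeal = Ideal.span {kobayashiL ε Lplus Lminus} := by
    rw [hξ, ← hspan]
    exact Ideal.span_singleton_eq_span_singleton.mpr (associated_mul_unit_right ξ δ hδunit)
  -- the period ratio `ϖ` is a `p`-adic unit
  have hirr : W.HasIrreducibleModPGaloisRep p :=
    hasIrreducibleModPGaloisRep_of_dvd_frobeniusTrace W p hp2
      (W.not_dvd_minimalDiscriminantInt_of_hasGoodReductionAtPrime' p hgood) (by rw [hap]; exact dvd_zero _)
  have hvϖ : padicValRat p ϖ = 0 := padicValRat_periodRatio_eq_zero h5 h3 W p hp2 hgood hirr f hf ϖ hϖ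
  have hϖ0 : ϖ ≠ 0 := by
    intro h0
    rw [h0, Rat.cast_zero, zero_mul] at hϖ
    exact (IsNewform0.plusPeriod_pos_holds hf.1 hf.coeffField_eq_bot).ne' hϖ.symm
  obtain ⟨u, hu⟩ := exists_units_coe_eq_ratCast hϖ0 hvϖ
  obtain ⟨hspan', hι⟩ := span_C_units_mul_eq u (kobayashiL ε Lplus Lminus)
  refine ⟨PowerSeries.C (u : ℤ_[p]) * kobayashiL ε Lplus Lminus, ?_, ?_⟩
  · rw [hchar, hspan']
  · rw [hι, hu]

/-- **The sign-blind rank squeeze at `p = 3`, modulo PUBLISHED facts only** (the μ-floor is input-free at `3`):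
`λ(L₃^{ε₁}) ≤ rank E(ℚ)` for ONE sign ⟹ Kobayashi's main conjecture for BOTH signs at `(E, 3)` — `E` good at `3`,
`a₃ = 0`, `ρ̄_{E,3}` onto. [cite: Kobayashi2003, Conjecture (p. 2), Thm. 4.1] [cite: Vaserstein1972SL2, Theorem] [cite: GreenbergLNM1716, §3 Lemma 3.1] -/
theorem kobayashiMainConjecture_forall_of_lam_le_mordellWeilRank_three
    (h12 : Kobayashi2003.thm12_signedSelmerDual_finite_torsion)
    (h41 : Kobayashi2003.thm41_signedCharIdeal_divisibility)
    (h5 : realPeriodRat_eq_unit_mul_plusPeriod) (h3 : realPeriodRat_eq_unit_mul_plusPeriod_three)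
    (hJ : Kobayashi2003.thm62_63_73_signedColemanKato_zetaJoint)
    (hp3 : p = 3) (hgood : W.HasGoodReductionAtPrime p) (hap : W.frobeniusTrace p = 0) (hs : Surj W p) (ε₁ : ℤˣ)
    (hcert : ∀ [NeZero (W.conductorNorm ℤ)] (f : CuspForm (Gamma0 (W.conductorNorm ℤ)) 2),
      IsNewformOf W f → ∀ Lplus Lminus : IwasawaAlgebra p, IsPollackPair f p Lplus Lminus →
        lam (kobayashiL ε₁ Lplus Lminus) ≤ W.mordellWeilRank) :
    ∀ ε : ℤˣ, KobayashiMainConjecture W p ε :=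
  kobayashiMainConjecture_forall_of_lam_le_mordellWeilRank_of_muFloor h12 h41 h5 h3 hJ
    (LargeImageMuFloor.signedMuFloor_three (W := W) p hp3 hgood hap) (by subst hp3; decide) hgood hap hs ε₁ hcert

/-- **The sign-blind rank squeeze at an odd prime, B⁰ only at `p ≥ 5`.** [cite: Kobayashi2003, Conjecture (p. 2), Thm. 4.1]
[cite: GreenbergLNM1716, §3 Lemma 3.1] [cite: PollackWeston2011, Rem. 4.2] -/
theorem kobayashiMainConjecture_forall_of_lam_le_mordellWeilRank_of_teichSpanGenAll
    (h12 : Kobayashi2003.thm12_signedSelmerDual_finite_torsion)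
    (h41 : Kobayashi2003.thm41_signedCharIdeal_divisibility)
    (h5 : realPeriodRat_eq_unit_mul_plusPeriod) (h3 : realPeriodRat_eq_unit_mul_plusPeriod_three)
    (hJ : Kobayashi2003.thm62_63_73_signedColemanKato_zetaJoint) (hB : TeichSpanGenAll)
    (hp2 : p ≠ 2) (hgood : W.HasGoodReductionAtPrime p) (hap : W.frobeniusTrace p = 0) (hs : Surj W p) (ε₁ : ℤˣ)
    (hcert : ∀ [NeZero (W.conductorNorm ℤ)] (f : CuspForm (Gamma0 (W.conductorNorm ℤ)) 2),
      IsNewformOf W f → ∀ Lplus Lminus : IwasawaAlgebra p, IsPollackPair f p Lplus Lminus →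
        lam (kobayashiL ε₁ Lplus Lminus) ≤ W.mordellWeilRank) :
    ∀ ε : ℤˣ, KobayashiMainConjecture W p ε :=
  kobayashiMainConjecture_forall_of_lam_le_mordellWeilRank_of_muFloor h12 h41 h5 h3 hJ
    (LargeImageMuFloor.signedMuFloor_of_teichSpanGenAll (W := W) hB hp2 hgood hap) hp2 hgood hap hs ε₁ hcert

/-- **Certificate in the `IsSignedPAdicLFunction` currency, at the conductor** (the shape of k3-c3's
`kobayashiMainConjecture_of_cert_of_le_mordellWeilRank_at_conductor`, with its `μ(L) = 0` clause DROPPED and its conclusion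
extended to BOTH signs): `p = 3` good, `a₃ = 0`, `ρ̄` onto, the newform `f₀` of `E`, a sign `ε₁`, and
`λ(L) ≤ rank E(ℚ)` for every `L` with `IsSignedPAdicLFunction f₀ 3 ε₁ L` ⟹ Kobayashi's main conjecture for every sign.
PUBLISHED facts only. [cite: Kobayashi2003, Conjecture (p. 2), Thm. 3.2, Thm. 4.1] [cite: Pollack2003, Prop. 6.18] -/
theorem kobayashiMainConjecture_forall_of_cert_at_conductor_three
    (h12 : Kobayashi2003.thm12_signedSelmerDual_finite_torsion)
    (h41 : Kobayashi2003.thm41_signedCharIdeal_divisibility)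
    (h5 : realPeriodRat_eq_unit_mul_plusPeriod) (h3 : realPeriodRat_eq_unit_mul_plusPeriod_three)
    (hJ : Kobayashi2003.thm62_63_73_signedColemanKato_zetaJoint)
    (hp3 : p = 3) (hgood : W.HasGoodReductionAtPrime p) (hap : W.frobeniusTrace p = 0) (hs : Surj W p) (ε₁ : ℤˣ)
    [NeZero (W.conductorNorm ℤ)] {f₀ : CuspForm (Gamma0 (W.conductorNorm ℤ)) 2} (hf₀ : IsNewformOf W f₀)
    (hcert₀ : ∀ L : IwasawaAlgebra p, IsSignedPAdicLFunction f₀ p ε₁ L → lam L ≤ W.mordellWeilRank) :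
    ∀ ε : ℤˣ, KobayashiMainConjecture W p ε := by
  refine kobayashiMainConjecture_forall_of_lam_le_mordellWeilRank_three h12 h41 h5 h3 hJ hp3 hgood hap hs ε₁ ?_
  intro _ f hf Lplus Lminus hPP
  have hff : f = f₀ := hf.unique hf₀
  subst hff
  exact hcert₀ _ (hPP.isSignedPAdicLFunction_kobayashiL ε₁)

/-- **The same at an odd prime, B⁰ only at `p ≥ 5`.** [cite: Kobayashi2003, Conjecture (p. 2), Thm. 3.2, Thm. 4.1] [cite: Pollack2003, Prop. 6.18] -/
theorem kobayashiMainConjecture_forall_of_cert_at_conductor_of_teichSpanGenAll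
    (h12 : Kobayashi2003.thm12_signedSelmerDual_finite_torsion)
    (h41 : Kobayashi2003.thm41_signedCharIdeal_divisibility)
    (h5 : realPeriodRat_eq_unit_mul_plusPeriod) (h3 : realPeriodRat_eq_unit_mul_plusPeriod_three)
    (hJ : Kobayashi2003.thm62_63_73_signedColemanKato_zetaJoint) (hB : TeichSpanGenAll)
    (hp2 : p ≠ 2) (hgood : W.HasGoodReductionAtPrime p) (hap : W.frobeniusTrace p = 0) (hs : Surj W p) (ε₁ : ℤˣ)
    [NeZero (W.conductorNorm ℤ)] {f₀ : CuspForm (Gamma0 (W.conductorNorm ℤ)) 2} (hf₀ : IsNewformOf W f₀)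
    (hcert₀ : ∀ L : IwasawaAlgebra p, IsSignedPAdicLFunction f₀ p ε₁ L → lam L ≤ W.mordellWeilRank) :
    ∀ ε : ℤˣ, KobayashiMainConjecture W p ε := by
  refine kobayashiMainConjecture_forall_of_lam_le_mordellWeilRank_of_teichSpanGenAll h12 h41 h5 h3 hJ hB hp2 hgood hap
    hs ε₁ ?_
  intro _ f hf Lplus Lminus hPP
  have hff : f = f₀ := hf.unique hf₀
  subst hff
  exact hcert₀ _ (hPP.isSignedPAdicLFunction_kobayashiL ε₁)

/-- **X7 reading — the crux's conclusion shape at ONE pair from ONE λ-inequality.**  On class X7 at an odd `p` with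
`a_p = 0` and `ρ̄` onto (the crux's binders; `¬CM` idle): `λ(L_p^{ε₁}) ≤ rank E(ℚ)` for one sign ⟹
`∃ ε, KobayashiLowerDivisibility W p ε` (indeed the full main conjecture for both signs).  GRANTED the published facts and B⁰
(only `p ≥ 5`).  PER PAIR in the certificate. [cite: Kobayashi2003, Conjecture (p. 2)] [cite: GreenbergLNM1716, §3 Lemma 3.1] -/
theorem X7.exists_kobayashiLowerDivisibility_of_lam_le_mordellWeilRank
    (h12 : Kobayashi2003.thm12_signedSelmerDual_finite_torsion)
    (h41 : Kobayashi2003.thm41_signedCharIdeal_divisibility)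
    (h5 : realPeriodRat_eq_unit_mul_plusPeriod) (h3 : realPeriodRat_eq_unit_mul_plusPeriod_three)
    (hJ : Kobayashi2003.thm62_63_73_signedColemanKato_zetaJoint) (hB : TeichSpanGenAll)
    (hp2 : p ≠ 2) (hX7 : ClassX7 W p) (hap : W.frobeniusTrace p = 0) (hs : Surj W p) (ε₁ : ℤˣ)
    (hcert : ∀ [NeZero (W.conductorNorm ℤ)] (f : CuspForm (Gamma0 (W.conductorNorm ℤ)) 2),
      IsNewformOf W f → ∀ Lplus Lminus : IwasawaAlgebra p, IsPollackPair f p Lplus Lminus →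
        lam (kobayashiL ε₁ Lplus Lminus) ≤ W.mordellWeilRank) :
    ∃ ε : ℤˣ, KobayashiLowerDivisibility W p ε :=
  ⟨ε₁, kobayashiLowerDivisibility_of_mainConjecture
    (kobayashiMainConjecture_forall_of_lam_le_mordellWeilRank_of_teichSpanGenAll h12 h41 h5 h3 hJ hB hp2 hX7.1.1 hap hs
      ε₁ hcert ε₁)⟩

end Squeeze

end Summit.BirchSwinnertonDyer.BirchSwinnertonDyer.Theorems.LargeImageMuPartSqueeze

end
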